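import Literature.AnabelianGeometry.EtaleTheta.Discharge.Sec5OfQuotientTemperoidRootData
import Literature.AnabelianGeometry.EtaleTheta.Discharge.Sec5OfBiKummerDataKummer

/-!
# [EtTh] Prop. 4.3 (iii) for the §5 data from an ARBITRARY root datum over `B^temp(G)⁰`: the bi-Kummer difference is `μ_N(B_N)`-valued

S. Mochizuki, *The étale theta function and its Frobenioid-theoretic manifestations*, Publ. RIMS **45** (2009) [MochizukiEtTh2009],
Prop. 4.3 (iii) p.317 (PDF p.91) ("the difference … determines a … class … in `μ_N`"), §5 p.331 (PDF p.105); Prop. 5.2 (i) p.324 (PDF p.98)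
[cite: MochizukiEtTh2009, Prop 4.3 (iii) p.317 (PDF p.91)].

abc-iut cell, layer L2 [EtTh]; seat abc-iut-L2-t3 (gen 10), row «JUNCTION TWIN» (abc-iut-L2-lead R1374/R1385), PROOF-ONLY sequel of the common
core `Sec5OfQuotientTemperoidRootData` (FINDING F-L2t3g10-3 «TWIN-FACTS»).  abc-iut-L2-t4's `Discharge/Sec5OfBiKummerDataKummer` proves the
§5 named input `BiKummerDifferenceMem` (Prop. 4.3 (iii)) for `ofBiKummerData` over the NESTED root binder `S.NthRoot Rl.root Rl.pair N`; its
proof (`strv_mem_HA`, `pull_unit_sgpCap_mul_root`, `sgpCap_mul_sgpCup_inv_pow_eq_one`) reads from the root ONLY `R.pow_root` and the `fixed`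
clause of `R.isSaturated` with respect to the setting TYPING THE ROOT, plus `Π^tp_Ÿ ⊆ H_⊙` of that setting.  This file is that proof
VERBATIM with the binder generalised to ANY root datum `R : S.NthRoot f P N` of the quotient-temperoid setting whose order equals the
order `N` of the §2 datum (`s^trv_N := strvOfRoot`, its section property a theorem):
* `strv_mem_HA_ofRoot`, `pull_unit_sgpCap_mul_root_ofQuotientTemperoidRootData`, `sgpCap_mul_sgpCup_inv_pow_eq_one_ofQuotientTemperoidRootData`;
* **`biKummerDifferenceMem_ofQuotientTemperoidRootData (hH) (toB) (hfrac) (haut)`** — `BiKummerDifferenceMem` for the core from `Π^tp_Ÿ ⊆ H_⊙`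
  (p.322) and the [FrdI] Thm. 5.2 (ii) dictionary laws `hfrac`/`haut` of an identification `toB` of birational units (identities at the
  identity dictionary); hence **`facts_ofQuotientTemperoidRootData'`** — `Facts ⟸ {hH, hfrac, haut, hK}`.
So print's FIRST form of Prop. 5.2 (i) — the single `(l·N)`-th root of `Θ̈`'s pair at the `A_⊙`-anchor, §2 datum at order `l·N` — has
`BiKummerDifferenceMem ∈ μ_{l·N}(B_{l·N})` DISCHARGED (instance file `Sec5OfQuotientTemperoidDataFirstForm`).
HONEST FRAMING: kernel-checked consequences for data so constructed; [EtTh]/[FrdI] are refereed prerequisite papers; nothing here bears on,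
or takes a side on, the disputed [IUTchIII] Cor. 3.12; nothing here asserts abc proved or refuted.
-/

noncomputable section

namespace Literature.AnabelianGeometry.EtaleTheta

open CategoryTheory Opposite Literature.AlgebraicGeometry.Frobenioids Literature.AnabelianGeometry.SemiGraphs
  Literature.AnabelianGeometry.SemiGraphs.GaloisObjects

universe u₀ v₀ u w

namespace ThetaFrobenioid

section Kummer

variable {K : Type u₀} [Field K] {X : SemiGraphs.TemperedArithmeticGroup.{u₀} K}
  {G : Type u} [Group G] [TopologicalSpace G] [IsTopologicalGroup G] {hG : IsTempered G}
  {φ : X.Pi →ₜ* G} {hφ : Function.Surjective φ}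
  {D₀ : Type u₀} [Category.{v₀} D₀] {V : FrdIMonoidStub.{w}} {T₀ : RealifiedDivisorMonoids (D₀ := D₀) V}
  {VD : FrdICatStub.{u + 1, u, w} (ConnectedPart (BTemp G))}
  {tf : TemperedFrobenioid T₀ (ConnectedPart (BTemp G)) VD} {hZ : tf.monoidType = MonoidType.Z}
  {hP : ∀ A : (ConnectedPart (BTemp G))ᵒᵖ, IsPerfect (tf.Φ.carrier A)}
  {NH : Subgroup (Field.absoluteGaloisGroup K) → tf.category → ℕ+ → Prop} {A₀ : tf.category}
  {hA₀ : PreFrobenioid.IsFrobeniusTrivial tf.toElem A₀} {hA₀' : SemiGraphs.IsGaloisObj A₀.base.obj}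
  {pullFrac : ∀ {A A' : (BiKummerSetting.mkOfQuotientTemperoid X hG φ hφ tf hZ hP NH A₀ hA₀ hA₀').C} (_ : A' ⟶ A), (BiKummerSetting.mkOfQuotientTemperoid X hG φ hφ tf hZ hP NH A₀ hA₀ hA₀').biratUnits A → (BiKummerSetting.mkOfQuotientTemperoid X hG φ hφ tf hZ hP NH A₀ hA₀ hA₀').biratUnits A'}
  {lv N : ℕ+} {T : ThetaEnvData.{max u w} N}
  {Af Bf : (BiKummerSetting.mkOfQuotientTemperoid X hG φ hφ tf hZ hP NH A₀ hA₀ hA₀').C} {f : (BiKummerSetting.mkOfQuotientTemperoid X hG φ hφ tf hZ hP NH A₀ hA₀ hA₀').biratUnits Af} {P : (BiKummerSetting.mkOfQuotientTemperoid X hG φ hφ tf hZ hP NH A₀ hA₀ hA₀').FractionPair f Bf} {Acirc : (BiKummerSetting.mkOfQuotientTemperoid X hG φ hφ tf hZ hP NH A₀ hA₀ hA₀').C}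
  (θ : (BiKummerSetting.mkOfQuotientTemperoid X hG φ hφ tf hZ hP NH A₀ hA₀ hA₀').biratUnits Acirc)
  (h : ModelFrobenioid.Hypotheses tf.divisorMonoid tf.ratFnFunctor)
  (Q : FrobenioidTheta.ThetaSubquotientStub.{w} (ConnectedPart (BTemp G))) (odd_l : Odd (lv : ℕ))
  (R : (BiKummerSetting.mkOfQuotientTemperoid X hG φ hφ tf hZ hP NH A₀ hA₀ hA₀').NthRoot f P N pullFrac)
  (ιX : T.PiX ≃ₜ* X.Pi) (K' : Type w) [Field K'] (constEmb : K'ˣ →* tf.biratUnitsModel R.BN)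
  (constEmb_injective : Function.Injective constEmb)
  (hinvc : ∀ g : Aut R.AN.base,
    pull tf.divisorMonoid g.hom (ModelFrobenioid.div R.pair.num) = ModelFrobenioid.div R.pair.num)
  (hinvp : ∀ y : T.PiX, y ∈ T.PiYdd →
    pull tf.divisorMonoid ((BiKummerSetting.mkOfQuotientTemperoid X hG φ hφ tf hZ hP NH A₀ hA₀ hA₀').galoisSurj R.AN.base R.αData.isGalois (ιX y)).hom (ModelFrobenioid.div R.pair.den) =
      ModelFrobenioid.div R.pair.den)

/-- `(s^⊔-gp_N(h))^bs = h` for the core (from `SgpCupSpec` and the section property). [cite: MochizukiEtTh2009, §5 p.331 (PDF p.105)] -/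
theorem sgpCupSection_ofQuotientTemperoidRootData : (ofQuotientTemperoidRootData θ h Q odd_l R ιX K' constEmb constEmb_injective hinvc hinvp).SgpCupSection :=
  sgpCupSection_of_spec _ (sgpCupSpec_ofQuotientTemperoidRootData θ h Q odd_l R ιX K' constEmb constEmb_injective hinvc hinvp)
    (strvSection_ofQuotientTemperoidRootData θ h Q odd_l R ιX K' constEmb constEmb_injective hinvc hinvp)

/-- `((s^⊓_N)^bs)⁻¹ ρ(y) (s^⊓_N)^bs = ρ_{A_N}(ιX y)` for the core. [cite: MochizukiEtTh2009, §5 p.331 (PDF p.105)] -/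
theorem ofQuotientTemperoidRootData_autBaseIsoAB_symm_ρ (y : T.PiX) :
    (ofQuotientTemperoidRootData θ h Q odd_l R ιX K' constEmb constEmb_injective hinvc hinvp).autBaseIsoAB.symm ((ofQuotientTemperoidRootData θ h Q odd_l R ιX K' constEmb constEmb_injective hinvc hinvp).ρ y) = (BiKummerSetting.mkOfQuotientTemperoid X hG φ hφ tf hZ hP NH A₀ hA₀ hA₀').galoisSurj R.AN.base R.αData.isGalois (ιX y) := by
  change (BiKummerSetting.NthRoot.baseIso _ R).conjAut.symm
    ((BiKummerSetting.NthRoot.baseIso _ R).conjAut ((BiKummerSetting.mkOfQuotientTemperoid X hG φ hφ tf hZ hP NH A₀ hA₀ hA₀').galoisSurj R.AN.base R.αData.isGalois (ιX y))) = _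
  exact MulEquiv.symm_apply_apply _ _


/-- `s^trv_N(h')` for `h' ∈ H_{A_N}` coming from `Π^tp_Ÿ ⊆ H_⊙` lies in abc-iut-L2-t3's `H_{A_N} ⊆ Aut_C(A_N)` (Def. 4.1 (ii): the
inverse image of `H_{A_N}^bs = Im(H_⊙ → Aut_D(A_N^bs))`), by the section property of `σ`.
[cite: MochizukiEtTh2009, Def 4.1 (ii) p.313 (PDF p.87)] -/
theorem strv_mem_HA_ofRoot
    (hH : ∀ y : T.PiX, y ∈ T.PiYdd → ιX y ∈ (BiKummerSetting.mkOfQuotientTemperoid X hG φ hφ tf hZ hP NH A₀ hA₀ hA₀').Hodot) (y : T.PiX) (hy : y ∈ T.PiYdd) :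
    strvOfRoot h R ((BiKummerSetting.mkOfQuotientTemperoid X hG φ hφ tf hZ hP NH A₀ hA₀ hA₀').galoisSurj R.AN.base R.αData.isGalois (ιX y)) ∈ (BiKummerSetting.mkOfQuotientTemperoid X hG φ hφ tf hZ hP NH A₀ hA₀ hA₀').HA R.AN R.αData.isGalois := by
  rw [BiKummerSetting.HA, Subgroup.mem_comap]
  have hb : (BiKummerSetting.mkOfQuotientTemperoid X hG φ hφ tf hZ hP NH A₀ hA₀ hA₀').autBase R.AN (strvOfRoot h R ((BiKummerSetting.mkOfQuotientTemperoid X hG φ hφ tf hZ hP NH A₀ hA₀ hA₀').galoisSurj R.AN.base R.αData.isGalois (ιX y))) =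
      (BiKummerSetting.mkOfQuotientTemperoid X hG φ hφ tf hZ hP NH A₀ hA₀ hA₀').galoisSurj R.AN.base R.αData.isGalois (ιX y) := Aut.ext (baseMap_strvOfRoot h R _)
  rw [hb]
  exact Subgroup.mem_map_of_mem _ (hH y hy)

/-- **The Kummer-cocycle identity** for the assembled data (Prop. 4.3 (iii), "follows immediately from the definitions", p.317
(PDF p.91)): with `x` the rational function of the root `f_N = s^⊓_N·(s^⊔_N)⁻¹` (via `toB`), `τ = s^trv_N(h')` and `b = (s^⊓_N)^bs`,
`b^* u_{s^⊓-gp_N(h)} · x = τ^* x · b^* u_{s^⊔-gp_N(h)}` in `B(A_N^bs)` — adapted from abc-iut-L6-t12's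
`BiKummerRoot.pull_unit_sNum_mul_root`.  [cite: MochizukiEtTh2009, Prop 4.3 (iii) p.317 (PDF p.91)] -/
theorem pull_unit_sgpCap_mul_root_ofQuotientTemperoidRootData (toB : ∀ A : (BiKummerSetting.mkOfQuotientTemperoid X hG φ hφ tf hZ hP NH A₀ hA₀ hA₀').C, (BiKummerSetting.mkOfQuotientTemperoid X hG φ hφ tf hZ hP NH A₀ hA₀ hA₀').biratUnits A →* (BiKummerSetting.mkOfQuotientTemperoid X hG φ hφ tf hZ hP NH A₀ hA₀ hA₀').tf.biratUnitsModel A)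
    (hfrac : ∀ {A B : (BiKummerSetting.mkOfQuotientTemperoid X hG φ hφ tf hZ hP NH A₀ hA₀ hA₀').C} (s' s'' : A ⟶ B) (h' : (BiKummerSetting.mkOfQuotientTemperoid X hG φ hφ tf hZ hP NH A₀ hA₀ hA₀').IsPreStep s') (h'' : (BiKummerSetting.mkOfQuotientTemperoid X hG φ hφ tf hZ hP NH A₀ hA₀ hA₀').IsPreStep s'')
      (hb : PreFrobenioid.BaseEquivalent (BiKummerSetting.mkOfQuotientTemperoid X hG φ hφ tf hZ hP NH A₀ hA₀ hA₀').F s' s''),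
      (toB A ((BiKummerSetting.mkOfQuotientTemperoid X hG φ hφ tf hZ hP NH A₀ hA₀ hA₀').fracOf s' s'' h' h'' hb) : (BiKummerSetting.mkOfQuotientTemperoid X hG φ hφ tf hZ hP NH A₀ hA₀ hA₀').tf.ratFnFunctor.obj (op A.base)) *
        ModelFrobenioid.unit s'' = ModelFrobenioid.unit s')
    (y : T.PiX) (hy : y ∈ T.PiYdd) :
    pull (BiKummerSetting.mkOfQuotientTemperoid X hG φ hφ tf hZ hP NH A₀ hA₀ hA₀').tf.ratFnFunctor (ModelFrobenioid.baseMap R.pair.num)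
        (ModelFrobenioid.unit ((ofQuotientTemperoidRootData θ h Q odd_l R ιX K' constEmb constEmb_injective hinvc hinvp).sgpCap
          (rhoOfRoot R ιX y)).hom) * (toB R.AN R.root : (BiKummerSetting.mkOfQuotientTemperoid X hG φ hφ tf hZ hP NH A₀ hA₀ hA₀').tf.ratFnFunctor.obj (op R.AN.base)) =
      pull (BiKummerSetting.mkOfQuotientTemperoid X hG φ hφ tf hZ hP NH A₀ hA₀ hA₀').tf.ratFnFunctor (ModelFrobenioid.baseMap (strvOfRoot h R ((BiKummerSetting.mkOfQuotientTemperoid X hG φ hφ tf hZ hP NH A₀ hA₀ hA₀').galoisSurj R.AN.base R.αData.isGalois (ιX y))).hom)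
          (toB R.AN R.root : (BiKummerSetting.mkOfQuotientTemperoid X hG φ hφ tf hZ hP NH A₀ hA₀ hA₀').tf.ratFnFunctor.obj (op R.AN.base)) *
        pull (BiKummerSetting.mkOfQuotientTemperoid X hG φ hφ tf hZ hP NH A₀ hA₀ hA₀').tf.ratFnFunctor (ModelFrobenioid.baseMap R.pair.num)
          (ModelFrobenioid.unit ((ofQuotientTemperoidRootData θ h Q odd_l R ιX K' constEmb constEmb_injective hinvc hinvp).sgpCup ⟨rhoOfRoot R ιX y, Subgroup.mem_map_of_mem _ hy⟩).hom) := by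
  haveI : IsCancelMul ((BiKummerSetting.mkOfQuotientTemperoid X hG φ hφ tf hZ hP NH A₀ hA₀ hA₀').tf.ratFnFunctor.obj (op R.AN.base)) :=
    isIntegral_iff_isCancelMul.mp (h.isGroupLike_rat R.AN.base).isPreDivisorial.isIntegral
  set 𝔉 := ofQuotientTemperoidRootData θ h Q odd_l R ιX K' constEmb constEmb_injective hinvc hinvp with h𝔉
  set τ := strvOfRoot h R ((BiKummerSetting.mkOfQuotientTemperoid X hG φ hφ tf hZ hP NH A₀ hA₀ hA₀').galoisSurj R.AN.base R.αData.isGalois (ιX y)) with hτ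
  have hb : ModelFrobenioid.baseMap R.pair.num = ModelFrobenioid.baseMap R.pair.den := R.pair.base_eq
  have hn1 : ModelFrobenioid.degFr R.pair.num = 1 := R.pair.isPreStep_num.1
  have hd1 : ModelFrobenioid.degFr R.pair.den = 1 := R.pair.isPreStep_den.1
  have hx := hfrac R.pair.num R.pair.den R.pair.isPreStep_num R.pair.isPreStep_den R.pair.base_eq
  rw [R.pair.frac_eq] at hx
  -- the two commutation relations, with `autBaseIsoAB.symm (ρ y) = galoisSurj (ιX y)`
  have hg' : 𝔉.autBaseIsoAB.symm (rhoOfRoot R ιX y) = (BiKummerSetting.mkOfQuotientTemperoid X hG φ hφ tf hZ hP NH A₀ hA₀ hA₀').galoisSurj R.AN.base R.αData.isGalois (ιX y) :=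
    ofQuotientTemperoidRootData_autBaseIsoAB_symm_ρ θ h Q odd_l R ιX K' constEmb constEmb_injective hinvc hinvp y
  have c1 : R.pair.num ≫ (𝔉.sgpCap (rhoOfRoot R ιX y)).hom = τ.hom ≫ R.pair.num := by
    have e := sgpCapSpec_ofQuotientTemperoidRootData θ h Q odd_l R ιX K' constEmb constEmb_injective hinvc hinvp
      (rhoOfRoot R ιX y)
    rw [hg'] at e
    exact e
  have c2 : R.pair.den ≫ (𝔉.sgpCup ⟨rhoOfRoot R ιX y, Subgroup.mem_map_of_mem _ hy⟩).hom =
      τ.hom ≫ R.pair.den := by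
    have e := sgpCupSpec_ofQuotientTemperoidRootData θ h Q odd_l R ιX K' constEmb constEmb_injective hinvc hinvp
      ⟨rhoOfRoot R ιX y, Subgroup.mem_map_of_mem _ hy⟩
    rw [hg'] at e
    exact e
  -- units of the two commutation relations
  have e1 := congrArg ModelFrobenioid.unit c1
  have e2 := congrArg ModelFrobenioid.unit c2
  rw [ModelFrobenioid.unit_comp_of_degFr_eq_one _ (ModelFrobenioid.degFr_eq_one_of_isIso _),
    ModelFrobenioid.unit_comp_pull, hn1, PNat.one_coe, pow_one] at e1
  rw [ModelFrobenioid.unit_comp_of_degFr_eq_one _ (ModelFrobenioid.degFr_eq_one_of_isIso _),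
    ModelFrobenioid.unit_comp_pull, hd1, PNat.one_coe, pow_one, ← hb] at e2
  apply mul_right_cancel (b := ModelFrobenioid.unit R.pair.den)
  calc pull (BiKummerSetting.mkOfQuotientTemperoid X hG φ hφ tf hZ hP NH A₀ hA₀ hA₀').tf.ratFnFunctor (ModelFrobenioid.baseMap R.pair.num)
          (ModelFrobenioid.unit (𝔉.sgpCap (rhoOfRoot R ιX y)).hom) *
          (toB R.AN R.root : (BiKummerSetting.mkOfQuotientTemperoid X hG φ hφ tf hZ hP NH A₀ hA₀ hA₀').tf.ratFnFunctor.obj (op R.AN.base)) * ModelFrobenioid.unit R.pair.den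
        = pull (BiKummerSetting.mkOfQuotientTemperoid X hG φ hφ tf hZ hP NH A₀ hA₀ hA₀').tf.ratFnFunctor (ModelFrobenioid.baseMap R.pair.num)
          (ModelFrobenioid.unit (𝔉.sgpCap (rhoOfRoot R ιX y)).hom) * ModelFrobenioid.unit R.pair.num := by
          rw [mul_assoc, hx]
    _ = pull (BiKummerSetting.mkOfQuotientTemperoid X hG φ hφ tf hZ hP NH A₀ hA₀ hA₀').tf.ratFnFunctor (ModelFrobenioid.baseMap τ.hom) (ModelFrobenioid.unit R.pair.num) *
          ModelFrobenioid.unit τ.hom := e1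
    _ = pull (BiKummerSetting.mkOfQuotientTemperoid X hG φ hφ tf hZ hP NH A₀ hA₀ hA₀').tf.ratFnFunctor (ModelFrobenioid.baseMap τ.hom) (toB R.AN R.root : (BiKummerSetting.mkOfQuotientTemperoid X hG φ hφ tf hZ hP NH A₀ hA₀ hA₀').tf.ratFnFunctor.obj (op R.AN.base)) *
          (pull (BiKummerSetting.mkOfQuotientTemperoid X hG φ hφ tf hZ hP NH A₀ hA₀ hA₀').tf.ratFnFunctor (ModelFrobenioid.baseMap τ.hom) (ModelFrobenioid.unit R.pair.den) *
            ModelFrobenioid.unit τ.hom) := by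
          rw [← hx, map_mul, mul_assoc]
    _ = pull (BiKummerSetting.mkOfQuotientTemperoid X hG φ hφ tf hZ hP NH A₀ hA₀ hA₀').tf.ratFnFunctor (ModelFrobenioid.baseMap τ.hom) (toB R.AN R.root : (BiKummerSetting.mkOfQuotientTemperoid X hG φ hφ tf hZ hP NH A₀ hA₀ hA₀').tf.ratFnFunctor.obj (op R.AN.base)) *
          (pull (BiKummerSetting.mkOfQuotientTemperoid X hG φ hφ tf hZ hP NH A₀ hA₀ hA₀').tf.ratFnFunctor (ModelFrobenioid.baseMap R.pair.num)
            (ModelFrobenioid.unit (𝔉.sgpCup ⟨rhoOfRoot R ιX y, Subgroup.mem_map_of_mem _ hy⟩).hom) *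
            ModelFrobenioid.unit R.pair.den) := by rw [← e2]
    _ = _ := by rw [mul_assoc]

set_option maxHeartbeats 1600000 in
/-- **Prop. 4.3 (iii), `N`-torsion, for the assembled data**: `(s^⊓-gp_N(h) · s^⊔-gp_N(h)⁻¹)^N = 1` for `h ∈ H_{B_N}` —
`τ = s^trv_N(h')` lies in `H_{A_N}` (`hH`: `Π^tp_Ÿ ⊆ H_⊙`; section property `hσ`), so it fixes `f|_{A_N} = f_N^N` (the
saturation clause of the root datum `R`, Def. 4.1 (iii)), and the Kummer cocycle of `f_N` is `N`-torsion; [FrdI] Thm. 5.2 (ii)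
dictionary laws `hfrac`, `haut`.  Adapted from abc-iut-L6-t12's `BiKummerRoot.sNum_mul_sDen_inv_pow_eq_one`.
[cite: MochizukiEtTh2009, Prop 4.3 (iii) p.317 (PDF p.91); §5 p.331 (PDF p.105)] -/
theorem sgpCap_mul_sgpCup_inv_pow_eq_one_ofQuotientTemperoidRootData
    (hH : ∀ y : T.PiX, y ∈ T.PiYdd → ιX y ∈ (BiKummerSetting.mkOfQuotientTemperoid X hG φ hφ tf hZ hP NH A₀ hA₀ hA₀').Hodot) (toB : ∀ A : (BiKummerSetting.mkOfQuotientTemperoid X hG φ hφ tf hZ hP NH A₀ hA₀ hA₀').C, (BiKummerSetting.mkOfQuotientTemperoid X hG φ hφ tf hZ hP NH A₀ hA₀ hA₀').biratUnits A →* (BiKummerSetting.mkOfQuotientTemperoid X hG φ hφ tf hZ hP NH A₀ hA₀ hA₀').tf.biratUnitsModel A)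
    (hfrac : ∀ {A B : (BiKummerSetting.mkOfQuotientTemperoid X hG φ hφ tf hZ hP NH A₀ hA₀ hA₀').C} (s' s'' : A ⟶ B) (h' : (BiKummerSetting.mkOfQuotientTemperoid X hG φ hφ tf hZ hP NH A₀ hA₀ hA₀').IsPreStep s') (h'' : (BiKummerSetting.mkOfQuotientTemperoid X hG φ hφ tf hZ hP NH A₀ hA₀ hA₀').IsPreStep s'')
      (hb : PreFrobenioid.BaseEquivalent (BiKummerSetting.mkOfQuotientTemperoid X hG φ hφ tf hZ hP NH A₀ hA₀ hA₀').F s' s''),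
      (toB A ((BiKummerSetting.mkOfQuotientTemperoid X hG φ hφ tf hZ hP NH A₀ hA₀ hA₀').fracOf s' s'' h' h'' hb) : (BiKummerSetting.mkOfQuotientTemperoid X hG φ hφ tf hZ hP NH A₀ hA₀ hA₀').tf.ratFnFunctor.obj (op A.base)) *
        ModelFrobenioid.unit s'' = ModelFrobenioid.unit s')
    (haut : ∀ {A : (BiKummerSetting.mkOfQuotientTemperoid X hG φ hφ tf hZ hP NH A₀ hA₀ hA₀').C} (e : Aut A) (x : (BiKummerSetting.mkOfQuotientTemperoid X hG φ hφ tf hZ hP NH A₀ hA₀ hA₀').biratUnits A),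
      (toB A ((BiKummerSetting.mkOfQuotientTemperoid X hG φ hφ tf hZ hP NH A₀ hA₀ hA₀').biratAut A e x) : (BiKummerSetting.mkOfQuotientTemperoid X hG φ hφ tf hZ hP NH A₀ hA₀ hA₀').tf.ratFnFunctor.obj (op A.base)) =
        pull (BiKummerSetting.mkOfQuotientTemperoid X hG φ hφ tf hZ hP NH A₀ hA₀ hA₀').tf.ratFnFunctor (ModelFrobenioid.baseMap e.inv) (toB A x : (BiKummerSetting.mkOfQuotientTemperoid X hG φ hφ tf hZ hP NH A₀ hA₀ hA₀').tf.ratFnFunctor.obj (op A.base)))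
    (y : T.PiX) (hy : y ∈ T.PiYdd) :
    ((ofQuotientTemperoidRootData θ h Q odd_l R ιX K' constEmb constEmb_injective hinvc hinvp).sgpCap
          (rhoOfRoot R ιX y) *
        ((ofQuotientTemperoidRootData θ h Q odd_l R ιX K' constEmb constEmb_injective hinvc hinvp).sgpCup
          ⟨rhoOfRoot R ιX y, Subgroup.mem_map_of_mem _ hy⟩)⁻¹) ^ (N : ℕ) = 1 := by
  set 𝔉 := ofQuotientTemperoidRootData θ h Q odd_l R ιX K' constEmb constEmb_injective hinvc hinvp with h𝔉
  set τ := strvOfRoot h R ((BiKummerSetting.mkOfQuotientTemperoid X hG φ hφ tf hZ hP NH A₀ hA₀ hA₀').galoisSurj R.AN.base R.αData.isGalois (ιX y)) with hτ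
  set hh : 𝔉.HB := ⟨rhoOfRoot R ιX y, Subgroup.mem_map_of_mem _ hy⟩ with hhh
  have hstriv : τ ∈ (BiKummerSetting.mkOfQuotientTemperoid X hG φ hφ tf hZ hP NH A₀ hA₀ hA₀').HA R.AN R.αData.isGalois := strv_mem_HA_ofRoot h R ιX hH y hy
  haveI : IsCancelMul ((BiKummerSetting.mkOfQuotientTemperoid X hG φ hφ tf hZ hP NH A₀ hA₀ hA₀').tf.ratFnFunctor.obj (op R.AN.base)) :=
    isIntegral_iff_isCancelMul.mp (h.isGroupLike_rat R.AN.base).isPreDivisorial.isIntegral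
  haveI : IsCancelMul ((BiKummerSetting.mkOfQuotientTemperoid X hG φ hφ tf hZ hP NH A₀ hA₀ hA₀').tf.ratFnFunctor.obj (op 𝔉.BN.base)) :=
    isIntegral_iff_isCancelMul.mp (h.isGroupLike_rat R.BN.base).isPreDivisorial.isIntegral
  haveI : IsIso (ModelFrobenioid.baseMap R.pair.num) := R.pair.isPreStep_num.2
  -- the Kummer-cocycle identity and its `N`-th power
  have E := pull_unit_sgpCap_mul_root_ofQuotientTemperoidRootData θ h Q odd_l R ιX K' constEmb constEmb_injective hinvc hinvp toB hfrac y hy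
  have hxN : (toB R.AN R.root : (BiKummerSetting.mkOfQuotientTemperoid X hG φ hφ tf hZ hP NH A₀ hA₀ hA₀').tf.ratFnFunctor.obj (op R.AN.base)) ^ (N : ℕ) =
      (toB R.AN (pullFrac R.αData.α₁ f) : (BiKummerSetting.mkOfQuotientTemperoid X hG φ hφ tf hZ hP NH A₀ hA₀ hA₀').tf.ratFnFunctor.obj (op R.AN.base)) := by
    rw [← Units.val_pow_eq_pow_val, ← map_pow, R.pow_root]
  have hfix : pull (BiKummerSetting.mkOfQuotientTemperoid X hG φ hφ tf hZ hP NH A₀ hA₀ hA₀').tf.ratFnFunctor (ModelFrobenioid.baseMap τ.hom)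
      (toB R.AN (pullFrac R.αData.α₁ f) : (BiKummerSetting.mkOfQuotientTemperoid X hG φ hφ tf hZ hP NH A₀ hA₀ hA₀').tf.ratFnFunctor.obj (op R.AN.base)) =
      (toB R.AN (pullFrac R.αData.α₁ f) : (BiKummerSetting.mkOfQuotientTemperoid X hG φ hφ tf hZ hP NH A₀ hA₀ hA₀').tf.ratFnFunctor.obj (op R.AN.base)) := by
    have hmem : τ⁻¹ ∈ (BiKummerSetting.mkOfQuotientTemperoid X hG φ hφ tf hZ hP NH A₀ hA₀ hA₀').HA R.AN R.αData.isGalois := Subgroup.inv_mem _ hstriv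
    have e : (toB R.AN ((BiKummerSetting.mkOfQuotientTemperoid X hG φ hφ tf hZ hP NH A₀ hA₀ hA₀').biratAut R.AN τ⁻¹ (pullFrac R.αData.α₁ f)) : (BiKummerSetting.mkOfQuotientTemperoid X hG φ hφ tf hZ hP NH A₀ hA₀ hA₀').tf.ratFnFunctor.obj (op R.AN.base)) =
        (toB R.AN (pullFrac R.αData.α₁ f) : (BiKummerSetting.mkOfQuotientTemperoid X hG φ hφ tf hZ hP NH A₀ hA₀ hA₀').tf.ratFnFunctor.obj (op R.AN.base)) :=
      congrArg (fun z : (BiKummerSetting.mkOfQuotientTemperoid X hG φ hφ tf hZ hP NH A₀ hA₀ hA₀').biratUnits R.AN => (toB R.AN z : (BiKummerSetting.mkOfQuotientTemperoid X hG φ hφ tf hZ hP NH A₀ hA₀ hA₀').tf.ratFnFunctor.obj (op R.AN.base)))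
        (R.isSaturated.fixed τ⁻¹ hmem)
    rwa [haut] at e
  have EN := congrArg (fun z => z ^ (N : ℕ)) E
  simp only [mul_pow] at EN
  rw [← map_pow, ← map_pow, ← map_pow, hxN, hfix, mul_comm _ (toB R.AN (pullFrac R.αData.α₁ f) :
    (BiKummerSetting.mkOfQuotientTemperoid X hG φ hφ tf hZ hP NH A₀ hA₀ hA₀').tf.ratFnFunctor.obj (op R.AN.base))] at EN
  have hpow : ModelFrobenioid.unit (𝔉.sgpCap (rhoOfRoot R ιX y)).hom ^ (N : ℕ) =
      ModelFrobenioid.unit (𝔉.sgpCup hh).hom ^ (N : ℕ) := by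
    apply PreFrobenioid.pull_injective (ModelFrobenioid.baseMap R.pair.num)
    exact mul_left_cancel EN
  -- the rational function of `w = s^⊓-gp(h) · s^⊔-gp(h)⁻¹` and of `w^N`
  have hw : 𝔉.sgpCap (rhoOfRoot R ιX y) * (𝔉.sgpCup hh)⁻¹ ∈ 𝔉.units 𝔉.BN := by
    have h1 := sgpCup_mul_sgpCap_inv_mem_units 𝔉
      (sgpCapSection_ofQuotientTemperoidRootData θ h Q odd_l R ιX K' constEmb constEmb_injective hinvc hinvp)
      (sgpCupSection_ofQuotientTemperoidRootData θ h Q odd_l R ιX K' constEmb constEmb_injective hinvc hinvp) hh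
    have h2 := Subgroup.inv_mem _ h1
    rwa [mul_inv_rev, inv_inv] at h2
  let w' : ModelFrobenioid.units 𝔉.BN := ⟨𝔉.sgpCap (rhoOfRoot R ιX y) * (𝔉.sgpCup hh)⁻¹, hw⟩
  have hu : ModelFrobenioid.unit (𝔉.sgpCap (rhoOfRoot R ιX y) * (𝔉.sgpCup hh)⁻¹).hom *
      pull (BiKummerSetting.mkOfQuotientTemperoid X hG φ hφ tf hZ hP NH A₀ hA₀ hA₀').tf.ratFnFunctor (ModelFrobenioid.baseMap (𝔉.sgpCup hh).inv) (ModelFrobenioid.unit (𝔉.sgpCup hh).hom) =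
      pull (BiKummerSetting.mkOfQuotientTemperoid X hG φ hφ tf hZ hP NH A₀ hA₀ hA₀').tf.ratFnFunctor (ModelFrobenioid.baseMap (𝔉.sgpCup hh).inv)
        (ModelFrobenioid.unit (𝔉.sgpCap (rhoOfRoot R ιX y)).hom) := by
    have e0 := congrArg ModelFrobenioid.unit (𝔉.sgpCup hh).inv_hom_id
    rw [ModelFrobenioid.unit_comp_of_degFr_eq_one _ (ModelFrobenioid.degFr_eq_one_of_isIso _),
      ModelFrobenioid.unit_id] at e0
    change ModelFrobenioid.unit ((𝔉.sgpCup hh).inv ≫ (𝔉.sgpCap (rhoOfRoot R ιX y)).hom) * _ = _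
    rw [ModelFrobenioid.unit_comp_of_degFr_eq_one _ (ModelFrobenioid.degFr_eq_one_of_isIso _), mul_assoc,
      mul_comm (ModelFrobenioid.unit (𝔉.sgpCup hh).inv), e0, mul_one]
  have huN : ModelFrobenioid.unit (𝔉.sgpCap (rhoOfRoot R ιX y) * (𝔉.sgpCup hh)⁻¹).hom ^ (N : ℕ) = 1 := by
    have e := congrArg (fun z => z ^ (N : ℕ)) hu
    simp only [mul_pow] at e
    rw [← map_pow, ← map_pow, hpow] at e
    exact mul_right_cancel (e.trans (one_mul _).symm)
  -- `O^×(B_N) ↪ B(Base B_N)^×` is injective (`Φ` integral): `w^N = 1`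
  have key : ModelFrobenioid.unitsToRatFn 𝔉.BN (w' ^ (N : ℕ)) = ModelFrobenioid.unitsToRatFn 𝔉.BN 1 := by
    rw [map_pow, map_one]
    apply Units.ext
    rw [Units.val_pow_eq_pow_val, ModelFrobenioid.coe_unitsToRatFn, Units.val_one]
    exact huN
  have hwN := ModelFrobenioid.unitsToRatFn_injective (h.isDivisorial R.BN.base).isPreDivisorial.isIntegral key
  have hfin : ((w' ^ (N : ℕ) : ModelFrobenioid.units 𝔉.BN) : Aut 𝔉.BN) = ((1 : ModelFrobenioid.units 𝔉.BN) : Aut 𝔉.BN) :=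
    congrArg Subtype.val hwN
  rw [Subgroup.coe_pow, Subgroup.coe_one] at hfin
  exact hfin

/-- **`BiKummerDifferenceMem` is a THEOREM for the assembled §5 data** ([EtTh] Prop. 4.3 (iii), p.317 (PDF p.91), for the
bi-Kummer `N`-th root `(s^⊓-gp_N, s^⊔-gp_N)` of p.331 (PDF p.105)): the difference `s^⊔-gp_N(h) · s^⊓-gp_N(h)⁻¹` lies in
`μ_N(B_N)` for every `h ∈ H_{B_N}`.  Inputs: `hσ` ([FrdI] Prop. 5.6), `hH` (`Π^tp_Ÿ ⊆ H_⊙`, p.322 (PDF p.96)), the [FrdI]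
Thm. 5.2 (ii) dictionary laws.  [cite: MochizukiEtTh2009, Prop 4.3 (iii) p.317 (PDF p.91); §5 p.331 (PDF p.105)] -/
theorem biKummerDifferenceMem_ofQuotientTemperoidRootData
    (hH : ∀ y : T.PiX, y ∈ T.PiYdd → ιX y ∈ (BiKummerSetting.mkOfQuotientTemperoid X hG φ hφ tf hZ hP NH A₀ hA₀ hA₀').Hodot) (toB : ∀ A : (BiKummerSetting.mkOfQuotientTemperoid X hG φ hφ tf hZ hP NH A₀ hA₀ hA₀').C, (BiKummerSetting.mkOfQuotientTemperoid X hG φ hφ tf hZ hP NH A₀ hA₀ hA₀').biratUnits A →* (BiKummerSetting.mkOfQuotientTemperoid X hG φ hφ tf hZ hP NH A₀ hA₀ hA₀').tf.biratUnitsModel A)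
    (hfrac : ∀ {A B : (BiKummerSetting.mkOfQuotientTemperoid X hG φ hφ tf hZ hP NH A₀ hA₀ hA₀').C} (s' s'' : A ⟶ B) (h' : (BiKummerSetting.mkOfQuotientTemperoid X hG φ hφ tf hZ hP NH A₀ hA₀ hA₀').IsPreStep s') (h'' : (BiKummerSetting.mkOfQuotientTemperoid X hG φ hφ tf hZ hP NH A₀ hA₀ hA₀').IsPreStep s'')
      (hb : PreFrobenioid.BaseEquivalent (BiKummerSetting.mkOfQuotientTemperoid X hG φ hφ tf hZ hP NH A₀ hA₀ hA₀').F s' s''),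
      (toB A ((BiKummerSetting.mkOfQuotientTemperoid X hG φ hφ tf hZ hP NH A₀ hA₀ hA₀').fracOf s' s'' h' h'' hb) : (BiKummerSetting.mkOfQuotientTemperoid X hG φ hφ tf hZ hP NH A₀ hA₀ hA₀').tf.ratFnFunctor.obj (op A.base)) *
        ModelFrobenioid.unit s'' = ModelFrobenioid.unit s')
    (haut : ∀ {A : (BiKummerSetting.mkOfQuotientTemperoid X hG φ hφ tf hZ hP NH A₀ hA₀ hA₀').C} (e : Aut A) (x : (BiKummerSetting.mkOfQuotientTemperoid X hG φ hφ tf hZ hP NH A₀ hA₀ hA₀').biratUnits A),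
      (toB A ((BiKummerSetting.mkOfQuotientTemperoid X hG φ hφ tf hZ hP NH A₀ hA₀ hA₀').biratAut A e x) : (BiKummerSetting.mkOfQuotientTemperoid X hG φ hφ tf hZ hP NH A₀ hA₀ hA₀').tf.ratFnFunctor.obj (op A.base)) =
        pull (BiKummerSetting.mkOfQuotientTemperoid X hG φ hφ tf hZ hP NH A₀ hA₀ hA₀').tf.ratFnFunctor (ModelFrobenioid.baseMap e.inv) (toB A x : (BiKummerSetting.mkOfQuotientTemperoid X hG φ hφ tf hZ hP NH A₀ hA₀ hA₀').tf.ratFnFunctor.obj (op A.base))) :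
    (ofQuotientTemperoidRootData θ h Q odd_l R ιX K' constEmb constEmb_injective hinvc hinvp).BiKummerDifferenceMem := by
  rw [biKummerDifferenceMem_iff]
  rintro ⟨x, y, hy, rfl⟩
  exact ⟨by
    have h1 := sgpCup_mul_sgpCap_inv_mem_units _
      (sgpCapSection_ofQuotientTemperoidRootData θ h Q odd_l R ιX K' constEmb constEmb_injective hinvc hinvp)
      (sgpCupSection_ofQuotientTemperoidRootData θ h Q odd_l R ιX K' constEmb constEmb_injective hinvc hinvp)
      ⟨rhoOfRoot R ιX y, Subgroup.mem_map_of_mem _ hy⟩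
    have h2 := Subgroup.inv_mem _ h1
    rwa [mul_inv_rev, inv_inv] at h2,
    sgpCap_mul_sgpCup_inv_pow_eq_one_ofQuotientTemperoidRootData θ h Q odd_l R ιX K' constEmb constEmb_injective hinvc
      hinvp hH toB hfrac haut y hy⟩

/-- **`Facts` for the core from `Π^tp_Ÿ ⊆ H_⊙`, the dictionary laws and `ConstantsActByCyclotome` (Lemma 5.8)** — Prop. 4.3 (iii)
DISCHARGED (`biKummerDifferenceMem_ofQuotientTemperoidRootData`).  [cite: MochizukiEtTh2009, §5 p.330–331 (PDF pp.104–105)] -/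
theorem facts_ofQuotientTemperoidRootData'
    (hH : ∀ y : T.PiX, y ∈ T.PiYdd → ιX y ∈ (BiKummerSetting.mkOfQuotientTemperoid X hG φ hφ tf hZ hP NH A₀ hA₀ hA₀').Hodot)
    (toB : ∀ A : (BiKummerSetting.mkOfQuotientTemperoid X hG φ hφ tf hZ hP NH A₀ hA₀ hA₀').C, (BiKummerSetting.mkOfQuotientTemperoid X hG φ hφ tf hZ hP NH A₀ hA₀ hA₀').biratUnits A →* (BiKummerSetting.mkOfQuotientTemperoid X hG φ hφ tf hZ hP NH A₀ hA₀ hA₀').tf.biratUnitsModel A)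
    (hfrac : ∀ {A B : (BiKummerSetting.mkOfQuotientTemperoid X hG φ hφ tf hZ hP NH A₀ hA₀ hA₀').C} (s' s'' : A ⟶ B) (h' : (BiKummerSetting.mkOfQuotientTemperoid X hG φ hφ tf hZ hP NH A₀ hA₀ hA₀').IsPreStep s') (h'' : (BiKummerSetting.mkOfQuotientTemperoid X hG φ hφ tf hZ hP NH A₀ hA₀ hA₀').IsPreStep s'')
      (hb : PreFrobenioid.BaseEquivalent (BiKummerSetting.mkOfQuotientTemperoid X hG φ hφ tf hZ hP NH A₀ hA₀ hA₀').F s' s''),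
      (toB A ((BiKummerSetting.mkOfQuotientTemperoid X hG φ hφ tf hZ hP NH A₀ hA₀ hA₀').fracOf s' s'' h' h'' hb) : (BiKummerSetting.mkOfQuotientTemperoid X hG φ hφ tf hZ hP NH A₀ hA₀ hA₀').tf.ratFnFunctor.obj (op A.base)) * ModelFrobenioid.unit s'' = ModelFrobenioid.unit s')
    (haut : ∀ {A : (BiKummerSetting.mkOfQuotientTemperoid X hG φ hφ tf hZ hP NH A₀ hA₀ hA₀').C} (e : Aut A) (x : (BiKummerSetting.mkOfQuotientTemperoid X hG φ hφ tf hZ hP NH A₀ hA₀ hA₀').biratUnits A),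
      (toB A ((BiKummerSetting.mkOfQuotientTemperoid X hG φ hφ tf hZ hP NH A₀ hA₀ hA₀').biratAut A e x) : (BiKummerSetting.mkOfQuotientTemperoid X hG φ hφ tf hZ hP NH A₀ hA₀ hA₀').tf.ratFnFunctor.obj (op A.base)) =
        pull (BiKummerSetting.mkOfQuotientTemperoid X hG φ hφ tf hZ hP NH A₀ hA₀ hA₀').tf.ratFnFunctor (ModelFrobenioid.baseMap e.inv) (toB A x : (BiKummerSetting.mkOfQuotientTemperoid X hG φ hφ tf hZ hP NH A₀ hA₀ hA₀').tf.ratFnFunctor.obj (op A.base)))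
    (hK : (ofQuotientTemperoidRootData θ h Q odd_l R ιX K' constEmb constEmb_injective hinvc hinvp).ConstantsActByCyclotome) : (ofQuotientTemperoidRootData θ h Q odd_l R ιX K' constEmb constEmb_injective hinvc hinvp).Facts :=
  facts_ofQuotientTemperoidRootData θ h Q odd_l R ιX K' constEmb constEmb_injective hinvc hinvp
    (biKummerDifferenceMem_ofQuotientTemperoidRootData θ h Q odd_l R ιX K' constEmb constEmb_injective hinvc hinvp hH toB hfrac
      haut) hK

end Kummer

end ThetaFrobenioid

end Literature.AnabelianGeometry.EtaleTheta

end
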